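import Summits.CriticalPhenomena.PercolationContinuityZ3.Theorems.PercNearOneGluingNoHeavyLowerTailMajorityGluingZFourteenEightP37
import Summits.CriticalPhenomena.PercolationContinuityZ3.Theorems.PercNearOneGluingNoHeavyLowerTailMajorityGluingZFourteenEightP38
import Summits.CriticalPhenomena.PercolationContinuityZ3.Theorems.PercNearOneGluingNoHeavyLowerTailMajorityGluingZFourteenEightP39
import Summits.CriticalPhenomena.PercolationContinuityZ3.Theorems.PercNearOneGluingNoHeavyLowerTailMajorityGluingZFourteenEightP40
import Summits.CriticalPhenomena.PercolationContinuityZ3.Theorems.PercNearOneGluingNoHeavyLowerTailMajorityGluingZFourteenEightP41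
import Summits.CriticalPhenomena.PercolationContinuityZ3.Theorems.PercNearOneGluingNoHeavyLowerTailMajorityGluingZFourteenEightP42
import Summits.CriticalPhenomena.PercolationContinuityZ3.Theorems.PercNearOneGluingNoHeavyLowerTailMajorityGluingZFourteenEightP43
import Summits.CriticalPhenomena.PercolationContinuityZ3.Theorems.PercNearOneGluingNoHeavyLowerTailMajorityGluingZFourteenEightP44
import Summits.CriticalPhenomena.PercolationContinuityZ3.Theorems.PercNearOneGluingNoHeavyLowerTailMajorityGluingZFourteenEightP45
import Summits.CriticalPhenomena.PercolationContinuityZ3.Theorems.PercNearOneGluingNoHeavyLowerTailMajorityGluingZFourteenEightP46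
import Summits.CriticalPhenomena.PercolationContinuityZ3.Theorems.PercNearOneGluingNoHeavyLowerTailMajorityGluingZFourteenEightP47
import Summits.CriticalPhenomena.PercolationContinuityZ3.Theorems.PercNearOneGluingNoHeavyLowerTailMajorityGluingZFourteenEightP48
import Summits.CriticalPhenomena.PercolationContinuityZ3.Theorems.PercNearOneGluingNoHeavyLowerTailMajorityGluingZFourteenEightHG4C1
import Summits.CriticalPhenomena.PercolationContinuityZ3.Theorems.PercNearOneGluingNoHeavyLowerTailMajorityGluingZFourteenEightHG4C2
import Summits.CriticalPhenomena.PercolationContinuityZ3.Theorems.PercNearOneGluingNoHeavyLowerTailMajorityGluingZFourteenEightHG4C3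
import Summits.CriticalPhenomena.PercolationContinuityZ3.Theorems.PercNearOneGluingNoHeavyLowerTailMajorityGluingZFourteenEightHG4C4
import Summits.CriticalPhenomena.PercolationContinuityZ3.Theorems.PercNearOneGluingNoHeavyLowerTailMajorityGluingZFourteenEightHG4C5
import Summits.CriticalPhenomena.PercolationContinuityZ3.Theorems.PercNearOneGluingNoHeavyLowerTailMajorityGluingZFourteenEightHG4C6
import Summits.CriticalPhenomena.PercolationContinuityZ3.Theorems.PercNearOneGluingNoHeavyLowerTailMajorityGluingZRangeAM
import HarnessLib

/-!
# Group 4 of 7 of the `(14,8)` certificate at `c = 3/2`: its aggregate-merge tree IS the concatenation of its 6 key-range chunks (lane prim-rate, constants-miner 1, gen 39; cert/mkhier.py)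

Support file for the closed crux `NoHeavyLowerTail` (stmt-CriticalPhenomena-4575), majority-gluing line.  The 12 parts P37, P38, P39, P40, P41, P42, P43, P44, P45, P46, P47, P48 (kit j310356) carry verified
type-space digests `…D`; `fourteenEightT2G4T` is their binary tree of aggregated merges (`am`, …MajorityGluingZRangeAM, depth 4); the kernel verifies `fourteenEightT2G4T = [chunks].flatten`
(`fourteenEightT2G4_eq`), and `fourteenEightT2G4_val` identifies the value of the group's digests with the value of its chunks (`evalC_am`).  No sorries. [cite: VandenbergKahn2001, Thm 1.2 (p. 123)]
-/

namespace Summit.CriticalPhenomena.PercolationContinuityZ3.Theorems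

namespace HubOnly
namespace QCert

/-- The aggregate-merge tree of group 4. -/
def fourteenEightT2G4T : List (ℕ × ℤ) :=
  am (am (am (am (fourteenEightTP37D) (fourteenEightTP38D)) (am (fourteenEightTP39D) (fourteenEightTP40D))) (am (am (fourteenEightTP41D) (fourteenEightTP42D)) (am (fourteenEightTP43D) (fourteenEightTP44D)))) (am (am (fourteenEightTP45D) (fourteenEightTP46D)) (am (fourteenEightTP47D) (fourteenEightTP48D)))

set_option maxRecDepth 8192 in
set_option maxHeartbeats 0 in
/-- **The tree of group 4 equals the concatenation of its key-range chunks** (kernel evaluation). -/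
theorem fourteenEightT2G4_eq : fourteenEightT2G4T = [fourteenEightT2G4C1, fourteenEightT2G4C2, fourteenEightT2G4C3, fourteenEightT2G4C4, fourteenEightT2G4C5, fourteenEightT2G4C6].flatten := by
  decide +kernel

/-- The tree's value is the value of the group's digests. -/
theorem fourteenEightT2G4_treeVal (val : ℕ → ℝ) : evalC val fourteenEightT2G4T = evalC val [fourteenEightTP37D, fourteenEightTP38D, fourteenEightTP39D, fourteenEightTP40D, fourteenEightTP41D, fourteenEightTP42D, fourteenEightTP43D, fourteenEightTP44D, fourteenEightTP45D, fourteenEightTP46D, fourteenEightTP47D, fourteenEightTP48D].flatten := by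
  simp only [fourteenEightT2G4T, evalC_am, List.flatten_cons, List.flatten_nil, evalC_append, evalC_nil', add_assoc, add_zero]

/-- **The value of group 4's digests is the value of its chunks.** -/
theorem fourteenEightT2G4_val (val : ℕ → ℝ) : evalC val [fourteenEightTP37D, fourteenEightTP38D, fourteenEightTP39D, fourteenEightTP40D, fourteenEightTP41D, fourteenEightTP42D, fourteenEightTP43D, fourteenEightTP44D, fourteenEightTP45D, fourteenEightTP46D, fourteenEightTP47D, fourteenEightTP48D].flatten = evalC val [fourteenEightT2G4C1, fourteenEightT2G4C2, fourteenEightT2G4C3, fourteenEightT2G4C4, fourteenEightT2G4C5, fourteenEightT2G4C6].flatten := by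
  rw [← fourteenEightT2G4_treeVal val, fourteenEightT2G4_eq]

end QCert
end HubOnly

end Summit.CriticalPhenomena.PercolationContinuityZ3.Theorems
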